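import Mathlib
import Literature.NumberTheory.LFunctions.Zhang2022.Section7ExtendedRangeBlocks
import Literature.NumberTheory.LFunctions.Zhang2022.Section7ExtendedRangeSum
import HarnessLib

/-!
# Zhang (2022) §7, G-adj2-1 (F3b): the extended-range triple sum — THE ROW'S DECL-WANTED

Topic `Literature/NumberTheory/LFunctions/Zhang2022` (Landau–Siegel audit tree; verdict-neutral).
Y. Zhang, *Discrete mean estimates and the Landau–Siegel zero*, arXiv:2211.02515v1 (2022)
[Zhang2022LandauSiegel] — **an unrefereed manuscript under adjudication**. D-0069 campaign, cell
`siegel-zhang`, GAP-LEDGER row G-adj2-1 (the printed (7.13) range `dhr < P₁` vs the (7.2)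
support `dhr < PT⁻²`).

* `sum_tripleX_le` — the (7.13)-shaped triple sum `Σ (dhφ(hr)√r)⁻¹ Σ*_θ |𝔰(r,h,d;θ)|` over ALL
  triples `1 ≤ d, h`, `1 < r` below the (7.2) support (`dhr < PT⁻²`, indices below
  `Nsupp = ⌈PT⁻²⌉`) is `≤ 2·P²·D^{−c}` for all large `D` under (A): the `r < D` part is
  `sum_tripleX_smallR_le` (F3a); the `r ≥ D` part is covered by dyadic blocks `R = D·2^i` and
  the extended-range (7.15) `eq715X` (F2b) — the landed `fiber713_le`/`blocks713_le`/
  `sum_bigR_le` bookkeeping with `⌈P₁⌉` replaced by `Nsupp` (`log Nsupp ≤ 2𝓛⁹`).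
* `extension713_sum_le` — **THE DECL-WANTED of GAP-LEDGER row G-adj2-1**: the same sum restricted
  to the dropped range `P₁ ≤ dhr < PT⁻²` (exactly the triples the printed (7.13) omits and never
  estimates) is `≤ 2·P²·D^{−c}` — a monotone corollary of `sum_tripleX_le`.

Theorems only; 0 new definitions; 0 new facts. The honest (7.12)→(7.13) insertion over the full
support and the closing `Eq711` assembly are the final file (F3c) of the rung.

WHAT THIS IS NOT: any claim about Theorems 1–2 of the manuscript or about Landau–Siegel zeros;
not a proof of (7.11) or of the printed (7.13); no change to the G-adj2-1 row's as-printed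
finding (the printed restriction remains not derivable as printed — this file bounds what the
print dropped).

## References

* Y. Zhang, arXiv:2211.02515v1 (2022), §7 pp. 37–39, (7.2), (7.13)–(7.15), tex L1813–L2058.
  [cite: Zhang2022LandauSiegel, §7 pp. 37–39]
-/

noncomputable section

open Complex Real Finset

namespace Literature.NumberTheory.LFunctions.Zhang2022.Section7cStatements

open Literature.NumberTheory.LFunctions.Zhang2022.Skeleton

open scoped Classical

/-! ## Elementary helpers (local copies of private lemmas of the lane, unchanged) -/

/-- `log D ≥ 1` once `D ≥ 3` (local copy). [folklore] -/
private theorem one_le_ellD {D : ℕ} (hD : 3 ≤ D) : 1 ≤ Skeleton.ell D := by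
  have hD' : (3 : ℝ) ≤ D := by exact_mod_cast hD
  rw [Skeleton.ell, Real.le_log_iff_exp_le (by linarith)]
  exact le_trans (le_of_lt (lt_trans Real.exp_one_lt_d9 (by norm_num))) hD'

/-- `1 ≤ P` (local copy). [folklore] -/
private theorem one_le_bigPD (D : ℕ) : 1 ≤ Skeleton.bigP D :=
  Real.one_le_exp (by rw [Skeleton.ell]; positivity)

/-- The harmonic bound `Σ_{1≤h<N} 1/h ≤ 1 + log N` (local copy). [folklore] -/
private theorem sum_Ico_inv_le_one_add_logD (N : ℕ) :
    ∑ h ∈ Finset.Ico 1 N, (1 : ℝ) / h ≤ 1 + Real.log N := by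
  rcases Nat.lt_or_ge N 2 with hN | hN
  · interval_cases N
    · simp
    · simp
  have hIco : Finset.Ico 1 N = Finset.Icc 1 (N - 1) := by
    ext h; simp only [Finset.mem_Ico, Finset.mem_Icc]; omega
  have h1 : ∑ h ∈ Finset.Icc 1 (N - 1), (1 : ℝ) / h = (harmonic (N - 1) : ℝ) := by
    rw [harmonic_eq_sum_Icc]; push_cast
    exact Finset.sum_congr rfl fun h _ => by rw [one_div]
  rw [hIco, h1]
  have h2 := harmonic_le_one_add_log (N - 1)
  have h3 : Real.log ((N - 1 : ℕ) : ℝ) ≤ Real.log N :=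
    Real.log_le_log (by exact_mod_cast (by omega : 0 < N - 1)) (by exact_mod_cast Nat.sub_le N 1)
  linarith

/-- `R^{−3/2} = (R√R)⁻¹` for `R > 0` (local copy). [folklore] -/
private theorem rpow_neg_three_halvesD {R : ℝ} (hR : 0 < R) :
    R ^ (-(3 / 2 : ℝ)) = (R * Real.sqrt R)⁻¹ := by
  rw [Real.rpow_neg hR.le, show (3 / 2 : ℝ) = 1 + 1 / 2 by norm_num,
    Real.rpow_add hR, Real.rpow_one, Real.sqrt_eq_rpow]

/-- The dyadic block of `r ≥ D ≥ 1` (local copy). [folklore] -/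
private theorem mem_dyadic_of_log_eqD {D r : ℕ} (hD : 0 < D) (hDr : D ≤ r) :
    r ∈ dyadic (((D * 2 ^ Nat.log 2 (r / D) : ℕ) : ℝ)) := by
  set i := Nat.log 2 (r / D) with hi
  have hq : r / D ≠ 0 := (Nat.div_pos hDr hD).ne'
  have h1 : D * 2 ^ i ≤ r := by
    have := Nat.pow_log_le_self 2 hq
    calc D * 2 ^ i ≤ D * (r / D) := Nat.mul_le_mul_left _ this
      _ ≤ r := Nat.mul_div_le r D
  have h2 : r < 2 * (D * 2 ^ i) := by
    have := Nat.lt_pow_succ_log_self (b := 2) (by norm_num) (r / D)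
    rw [Nat.div_lt_iff_lt_mul hD, pow_succ] at this
    calc r < 2 ^ i * 2 * D := this
      _ = 2 * (D * 2 ^ i) := by ring
  rw [dyadic, Finset.mem_filter, Finset.mem_range]
  have h1' : ((D * 2 ^ i : ℕ) : ℝ) ≤ r := by exact_mod_cast h1
  have h2' : (r : ℝ) < 2 * ((D * 2 ^ i : ℕ) : ℝ) := by exact_mod_cast h2
  refine ⟨?_, h1', h2'⟩
  rw [Nat.lt_ceil]
  exact h2'

/-- `K·𝓛ᵏ·D^{−c} ≤ η` for `D` large (local copy of the lane's eventual-decay lemma). [folklore] -/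
private theorem ell_pow_mul_rpow_neg_eventuallyD (k : ℕ) {c : ℝ} (hc : 0 < c) {η : ℝ}
    (hη : 0 < η) (K : ℝ) : ∃ D₀ : ℕ, ∀ D : ℕ, D₀ ≤ D →
      K * Skeleton.ell D ^ k * (D : ℝ) ^ (-c) ≤ η := by
  set K' : ℝ := max K 0 with hK'
  set A : ℝ := K' * (Nat.factorial k : ℝ) * (2 / c) ^ k with hA
  have hA0 : 0 ≤ A := by positivity
  set x₀ : ℝ := max 0 (2 / c * Real.log ((A + 1) / η)) with hx₀
  refine ⟨⌈Real.exp x₀⌉₊, fun D hD => ?_⟩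
  have hexpD : Real.exp x₀ ≤ D := le_trans (Nat.le_ceil _) (by exact_mod_cast hD)
  have hDpos : (0 : ℝ) < D := lt_of_lt_of_le (Real.exp_pos _) hexpD
  have hx : x₀ ≤ Skeleton.ell D := by
    rw [Skeleton.ell]; exact (Real.le_log_iff_exp_le hDpos).mpr hexpD
  have hℓ0 : 0 ≤ Skeleton.ell D := le_trans (le_max_left _ _) hx
  have hrpow : (D : ℝ) ^ (-c) = Real.exp (-(c * Skeleton.ell D)) := by
    rw [Real.rpow_def_of_pos hDpos, Skeleton.ell]; ring_nf
  have hpow : Skeleton.ell D ^ k ≤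
      (Nat.factorial k : ℝ) * (2 / c) ^ k * Real.exp (c * Skeleton.ell D / 2) := by
    have h := Real.pow_div_factorial_le_exp (c * Skeleton.ell D / 2) (by positivity) k
    have hk : (0 : ℝ) < Nat.factorial k := by exact_mod_cast Nat.factorial_pos k
    rw [div_le_iff₀ hk] at h
    have hc2 : (c * Skeleton.ell D / 2) ^ k = (c / 2) ^ k * Skeleton.ell D ^ k := by
      rw [← mul_pow]; ring
    rw [hc2] at h
    have hcpos : 0 < (c / 2) ^ k := by positivity
    calc Skeleton.ell D ^ k = (c / 2) ^ k * Skeleton.ell D ^ k * ((c / 2) ^ k)⁻¹ := by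
          field_simp
      _ ≤ Real.exp (c * Skeleton.ell D / 2) * Nat.factorial k * ((c / 2) ^ k)⁻¹ :=
          mul_le_mul_of_nonneg_right h (by positivity)
      _ = (Nat.factorial k : ℝ) * (2 / c) ^ k * Real.exp (c * Skeleton.ell D / 2) := by
          rw [show ((c / 2) ^ k)⁻¹ = (2 / c) ^ k by rw [← inv_pow, inv_div]]; ring
  have htail : Real.exp (-(c * Skeleton.ell D / 2)) ≤ η / (A + 1) := by
    have h1 : 2 / c * Real.log ((A + 1) / η) ≤ Skeleton.ell D :=
      le_trans (le_max_right _ _) hx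
    have h2 : Real.log ((A + 1) / η) ≤ c * Skeleton.ell D / 2 := by
      have := mul_le_mul_of_nonneg_left h1 (show 0 ≤ c / 2 by positivity)
      calc Real.log ((A + 1) / η) = c / 2 * (2 / c * Real.log ((A + 1) / η)) := by
            field_simp
        _ ≤ c / 2 * Skeleton.ell D := this
        _ = c * Skeleton.ell D / 2 := by ring
    calc Real.exp (-(c * Skeleton.ell D / 2)) ≤ Real.exp (-Real.log ((A + 1) / η)) :=
          Real.exp_le_exp.mpr (neg_le_neg h2)
      _ = η / (A + 1) := by
          rw [Real.exp_neg, Real.exp_log (by positivity), inv_div]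
  calc K * Skeleton.ell D ^ k * (D : ℝ) ^ (-c)
      ≤ K' * Skeleton.ell D ^ k * (D : ℝ) ^ (-c) :=
        mul_le_mul_of_nonneg_right (mul_le_mul_of_nonneg_right (le_max_left _ _)
          (pow_nonneg hℓ0 _)) (Real.rpow_nonneg hDpos.le _)
    _ ≤ K' * ((Nat.factorial k : ℝ) * (2 / c) ^ k * Real.exp (c * Skeleton.ell D / 2)) *
          (D : ℝ) ^ (-c) :=
        mul_le_mul_of_nonneg_right (mul_le_mul_of_nonneg_left hpow (le_max_right _ _))
          (Real.rpow_nonneg hDpos.le _)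
    _ = A * (Real.exp (c * Skeleton.ell D / 2) * Real.exp (-(c * Skeleton.ell D))) := by
        rw [hrpow, hA]; ring
    _ = A * Real.exp (-(c * Skeleton.ell D / 2)) := by rw [← Real.exp_add]; ring_nf
    _ ≤ A * (η / (A + 1)) := mul_le_mul_of_nonneg_left htail hA0
    _ ≤ η := by
        rw [mul_div_assoc']
        rw [div_le_iff₀ (by positivity)]
        nlinarith

/-- Size facts for `N₁ = Nsupp` (local copy of F3a's): once `𝓛 ≥ 2`, `3 ≤ N₁`, `log N₁ ≤ 2𝓛⁹`.
[cite: Zhang2022LandauSiegel, §7 (7.2); §2 (2.8)] -/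
private theorem nsupp_factsD {D : ℕ} (hℓ2 : 2 ≤ Skeleton.ell D) :
    3 ≤ Skeleton.Nsupp D ∧ Real.log ((Skeleton.Nsupp D : ℕ) : ℝ) ≤ 2 * Skeleton.ell D ^ 9 := by
  have hℓ0 : 0 < Skeleton.ell D := by linarith
  set L := Skeleton.ell D with hL
  have hP : 0 < Skeleton.bigP D := Real.exp_pos _
  have hL11 : L ^ (1.1 : ℝ) ≤ L ^ 2 := by
    calc L ^ (1.1 : ℝ) ≤ L ^ ((2 : ℕ) : ℝ) :=
          Real.rpow_le_rpow_of_exponent_le (by linarith) (by norm_num)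
      _ = L ^ 2 := Real.rpow_natCast L 2
  have hexp : 2 + 2 * L ^ (1.1 : ℝ) ≤ L ^ 9 := by
    have h2 : L ^ 9 = L ^ 7 * L ^ 2 := by ring
    have h3 : (2 : ℝ) ^ 7 ≤ L ^ 7 := pow_le_pow_left₀ (by norm_num) hℓ2 7
    have h4 : (1 : ℝ) ≤ L ^ 2 := one_le_pow₀ (by linarith)
    nlinarith [pow_nonneg hℓ0.le 7, pow_nonneg hℓ0.le 2]
  have hPT : Real.exp 2 ≤ Skeleton.bigP D / Skeleton.bigT D ^ 2 := by
    have e1 : Skeleton.bigP D / Skeleton.bigT D ^ 2 =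
        Real.exp (L ^ 9 - 2 * L ^ (1.1 : ℝ)) := by
      rw [Skeleton.bigP, Skeleton.bigT, sq, ← Real.exp_add, ← Real.exp_sub, ← hL]
      ring_nf
    rw [e1]
    exact Real.exp_le_exp.mpr (by linarith)
  have hN3 : 3 ≤ Skeleton.Nsupp D := by
    have h3e : (3 : ℝ) ≤ Real.exp 2 := by
      have := Real.add_one_le_exp (2 : ℝ); linarith
    have h1 : (3 : ℝ) ≤ Skeleton.bigP D / Skeleton.bigT D ^ 2 := h3e.trans hPT
    have hle := Nat.le_ceil (Skeleton.bigP D / Skeleton.bigT D ^ 2)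
    have : (3 : ℝ) ≤ ((⌈Skeleton.bigP D / Skeleton.bigT D ^ 2⌉₊ : ℕ) : ℝ) := h1.trans hle
    rw [Skeleton.Nsupp]
    exact_mod_cast this
  refine ⟨hN3, ?_⟩
  have hT1 : 1 ≤ Skeleton.bigT D ^ 2 :=
    one_le_pow₀ (Real.one_le_exp (Real.rpow_nonneg hℓ0.le _))
  have hPT2 : Skeleton.bigP D / Skeleton.bigT D ^ 2 ≤ Skeleton.bigP D :=
    div_le_self hP.le hT1
  have hceil : ((Skeleton.Nsupp D : ℕ) : ℝ) ≤ 2 * Skeleton.bigP D := by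
    rw [Skeleton.Nsupp]
    have h1 := Nat.ceil_lt_add_one
      (show 0 ≤ Skeleton.bigP D / Skeleton.bigT D ^ 2 by positivity)
    have hP1 : 1 ≤ Skeleton.bigP D := one_le_bigPD D
    calc ((⌈Skeleton.bigP D / Skeleton.bigT D ^ 2⌉₊ : ℕ) : ℝ)
        ≤ Skeleton.bigP D / Skeleton.bigT D ^ 2 + 1 := h1.le
      _ ≤ Skeleton.bigP D + Skeleton.bigP D := by linarith [hPT2]
      _ = 2 * Skeleton.bigP D := by ring
  have hpos : (0 : ℝ) < ((Skeleton.Nsupp D : ℕ) : ℝ) := by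
    exact_mod_cast (by omega : 0 < Skeleton.Nsupp D)
  have hlog2 : Real.log 2 ≤ 1 := by
    have := Real.log_le_sub_one_of_pos (show (0:ℝ) < 2 by norm_num); linarith
  have hL9 : 1 ≤ L ^ 9 := one_le_pow₀ (by linarith)
  calc Real.log ((Skeleton.Nsupp D : ℕ) : ℝ) ≤ Real.log (2 * Skeleton.bigP D) :=
        Real.log_le_log hpos hceil
    _ = Real.log 2 + L ^ 9 := by
        rw [Real.log_mul (by norm_num) hP.ne', Skeleton.bigP, Real.log_exp, ← hL]
    _ ≤ 2 * L ^ 9 := by linarith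

/-! ## One dyadic block of the `r ≥ D` part -/

set_option maxHeartbeats 800000 in
/-- **One dyadic block on the X-range** (the landed `fiber713_le` with `⌈P₁⌉ ↦ Nsupp` and the
(7.15)-input in its extended-range form): for `1 ≤ d, h < Nsupp` and a block index `i`
(`R = D·2^i`), the part of the extended (7.13)-sum over `r ∈ [R, 2R)` with `dhr < PT⁻²`, `r ≥ D`
is at most `Λ·C₃τ₅(d)P²D^{−c₃}/(dh)`, `Λ = (1 + log(Nsupp²))²`.
[cite: Zhang2022LandauSiegel, §7 (7.13)–(7.15) pp.37–38, tex L2005–L2030] -/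
private theorem fiber713X_le (c' : ℝ) {D : ℕ} (a₁ : ℕ → ℂ) {C₃ c₃ : ℝ} (hC₃ : 0 ≤ C₃)
    (hD : 0 < D)
    (h715D : ∀ (d h : ℕ) (R : ℝ), 0 < d → 0 < h → (D : ℝ) ≤ R →
      R * ((d * h : ℕ) : ℝ) ≤ Skeleton.bigP D / Skeleton.bigT D ^ 2 →
      R ^ (-(3 / 2 : ℝ)) * ∑ r ∈ dyadic R, ∑ θ : DirichletCharacter ℂ r,
          (if θ.IsPrimitive then ‖frakS c' D a₁ r h d θ‖ else 0) ≤
        C₃ * MeanSquareMajorant.tau 5 d * (h : ℝ) * bigP D ^ 2 * (D : ℝ) ^ (-c₃))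
    {d h : ℕ} (hd : d ∈ Finset.Ico 1 (Skeleton.Nsupp D))
    (hh : h ∈ Finset.Ico 1 (Skeleton.Nsupp D)) (i : ℕ) :
    ∑ r ∈ ((Finset.Ico 2 (Skeleton.Nsupp D)).filter
        (fun r => ((d * h * r : ℕ) : ℝ) < Skeleton.bigP D / Skeleton.bigT D ^ 2 ∧
          ¬ r < D)).filter (fun r => Nat.log 2 (r / D) = i),
        term713 c' D a₁ (d, h, r) ≤
      (1 + Real.log ((((Skeleton.Nsupp D : ℕ) : ℝ)) ^ 2)) ^ 2 * C₃ *
        MeanSquareMajorant.tau 5 d * bigP D ^ 2 * (D : ℝ) ^ (-c₃) / ((d : ℝ) * h) := by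
  rw [Finset.mem_Ico] at hd hh
  set N₁ : ℕ := Skeleton.Nsupp D with hN₁
  set Λ : ℝ := (1 + Real.log (((N₁ : ℕ) : ℝ) ^ 2)) ^ 2 with hΛ
  set R : ℝ := ((D * 2 ^ i : ℕ) : ℝ) with hR
  set F := ((Finset.Ico 2 N₁).filter
    (fun r => ((d * h * r : ℕ) : ℝ) < Skeleton.bigP D / Skeleton.bigT D ^ 2 ∧ ¬ r < D)).filter
    (fun r => Nat.log 2 (r / D) = i) with hF
  set V : ℕ → ℝ := fun r => ∑ θ : DirichletCharacter ℂ r,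
    (if θ.IsPrimitive then ‖frakS c' D a₁ r h d θ‖ else 0) with hV
  have hV0 : ∀ r, 0 ≤ V r := fun r => Finset.sum_nonneg fun θ _ => by
    split_ifs
    · exact norm_nonneg _
    · exact le_rfl
  have hd0 : (0 : ℝ) < d := by exact_mod_cast hd.1
  have hh0 : (0 : ℝ) < h := by exact_mod_cast hh.1
  have hRpos : 0 < R := by rw [hR]; exact_mod_cast Nat.mul_pos hD (pow_pos two_pos i)
  have hτ0 : 0 ≤ MeanSquareMajorant.tau 5 d := MeanSquareMajorant.tau_nonneg 5 d
  have hΦ0 : 0 ≤ Λ * C₃ * MeanSquareMajorant.tau 5 d * bigP D ^ 2 * (D : ℝ) ^ (-c₃) /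
      ((d : ℝ) * h) := by
    positivity
  -- members of the fiber
  have hmem : ∀ r ∈ F, 2 ≤ r ∧ r < N₁ ∧
      ((d * h * r : ℕ) : ℝ) < Skeleton.bigP D / Skeleton.bigT D ^ 2 ∧ D ≤ r ∧
      r ∈ dyadic R := by
    intro r hr
    rw [hF, Finset.mem_filter, Finset.mem_filter, Finset.mem_Ico] at hr
    obtain ⟨⟨⟨h2, hN⟩, hP, hDr⟩, hlog⟩ := hr
    push Not at hDr
    refine ⟨h2, hN, hP, hDr, ?_⟩
    rw [hR, ← hlog]
    exact mem_dyadic_of_log_eqD hD hDr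
  by_cases hne : F = ∅
  · rw [hne, Finset.sum_empty]; exact hΦ0
  obtain ⟨r₀, hr₀⟩ := Finset.nonempty_of_ne_empty hne
  obtain ⟨h2₀, -, hP₀, -, hdy₀⟩ := hmem r₀ hr₀
  -- the X-range condition for `R`
  have hRr₀ : R ≤ r₀ := (Finset.mem_filter.mp hdy₀).2.1
  have hrangeDR : (D : ℝ) ≤ R := by
    rw [hR]; exact_mod_cast Nat.le_mul_of_pos_right D (pow_pos two_pos i)
  have hrangeRX : R * ((d * h : ℕ) : ℝ) ≤ Skeleton.bigP D / Skeleton.bigT D ^ 2 := by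
    have hdh : (0 : ℝ) < ((d * h : ℕ) : ℝ) := by push_cast; positivity
    have hP₀' : ((d * h : ℕ) : ℝ) * r₀ < Skeleton.bigP D / Skeleton.bigT D ^ 2 := by
      have hcast : ((d * h * r₀ : ℕ) : ℝ) = ((d * h : ℕ) : ℝ) * r₀ := by push_cast; ring
      rw [← hcast]
      exact hP₀
    calc R * ((d * h : ℕ) : ℝ) ≤ (r₀ : ℝ) * ((d * h : ℕ) : ℝ) :=
          mul_le_mul_of_nonneg_right hRr₀ hdh.le
      _ = ((d * h : ℕ) : ℝ) * r₀ := mul_comm _ _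
      _ ≤ Skeleton.bigP D / Skeleton.bigT D ^ 2 := hP₀'.le
  -- (7.15X) on this block
  have h715 := h715D d h R hd.1 hh.1 hrangeDR hrangeRX
  rw [rpow_neg_three_halvesD hRpos] at h715
  have hRR : 0 < R * Real.sqrt R := mul_pos hRpos (Real.sqrt_pos.mpr hRpos)
  have hblock : ∑ r ∈ dyadic R, V r ≤
      R * Real.sqrt R * (C₃ * MeanSquareMajorant.tau 5 d * (h : ℝ) * bigP D ^ 2 *
        (D : ℝ) ^ (-c₃)) := by
    rw [inv_mul_le_iff₀ hRR] at h715
    exact h715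
  -- the weight bound on the fiber and the comparison with the full dyadic block
  have hw : ∀ r ∈ F, term713 c' D a₁ (d, h, r) ≤
      Λ / ((d : ℝ) * (h : ℝ) ^ 2 * (R * Real.sqrt R)) * V r := by
    intro r hr
    obtain ⟨h2, hN, -, -, hdy⟩ := hmem r hr
    have hRr : R ≤ r := (Finset.mem_filter.mp hdy).2.1
    have hM : ((h * r : ℕ) : ℝ) ≤ ((N₁ : ℕ) : ℝ) ^ 2 := by
      have : h * r ≤ N₁ * N₁ := Nat.mul_le_mul hh.2.le hN.le
      calc ((h * r : ℕ) : ℝ) ≤ ((N₁ * N₁ : ℕ) : ℝ) := by exact_mod_cast this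
        _ = ((N₁ : ℕ) : ℝ) ^ 2 := by push_cast; ring
    have hwt := weight713_le (d := d) (h := h) (r := r) hd.1 hh.1 hRpos hRr hM (by omega)
    unfold term713
    exact mul_le_mul_of_nonneg_right hwt (hV0 r)
  calc ∑ r ∈ F, term713 c' D a₁ (d, h, r)
      ≤ ∑ r ∈ F, Λ / ((d : ℝ) * (h : ℝ) ^ 2 * (R * Real.sqrt R)) * V r :=
        Finset.sum_le_sum hw
    _ = Λ / ((d : ℝ) * (h : ℝ) ^ 2 * (R * Real.sqrt R)) * ∑ r ∈ F, V r := by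
        rw [Finset.mul_sum]
    _ ≤ Λ / ((d : ℝ) * (h : ℝ) ^ 2 * (R * Real.sqrt R)) * ∑ r ∈ dyadic R, V r := by
        refine mul_le_mul_of_nonneg_left ?_ (by positivity)
        exact Finset.sum_le_sum_of_subset_of_nonneg (fun r hr => (hmem r hr).2.2.2.2)
          (fun r _ _ => hV0 r)
    _ ≤ Λ / ((d : ℝ) * (h : ℝ) ^ 2 * (R * Real.sqrt R)) *
          (R * Real.sqrt R * (C₃ * MeanSquareMajorant.tau 5 d * (h : ℝ) * bigP D ^ 2 *
            (D : ℝ) ^ (-c₃))) := mul_le_mul_of_nonneg_left hblock (by positivity)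
    _ = Λ * C₃ * MeanSquareMajorant.tau 5 d * bigP D ^ 2 * (D : ℝ) ^ (-c₃) / ((d : ℝ) * h) := by
        field_simp

set_option maxHeartbeats 800000 in
/-- **All dyadic blocks for fixed `d, h`** (the landed `blocks713_le` with `⌈P₁⌉ ↦ Nsupp`): the
part of the extended (7.13)-sum over `r ≥ D` (with `dhr < PT⁻²`, `2 ≤ r < Nsupp`) is at most
`(I+1)·Λ·C₃τ₅(d)P²D^{−c₃}/(dh)`, `I = ⌊log₂ Nsupp⌋`.
[cite: Zhang2022LandauSiegel, §7 (7.13)–(7.15) pp.37–38, tex L2005–L2030] -/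
private theorem blocks713X_le (c' : ℝ) {D : ℕ} (a₁ : ℕ → ℂ) {C₃ c₃ : ℝ} (hC₃ : 0 ≤ C₃)
    (hD : 0 < D)
    (h715D : ∀ (d h : ℕ) (R : ℝ), 0 < d → 0 < h → (D : ℝ) ≤ R →
      R * ((d * h : ℕ) : ℝ) ≤ Skeleton.bigP D / Skeleton.bigT D ^ 2 →
      R ^ (-(3 / 2 : ℝ)) * ∑ r ∈ dyadic R, ∑ θ : DirichletCharacter ℂ r,
          (if θ.IsPrimitive then ‖frakS c' D a₁ r h d θ‖ else 0) ≤
        C₃ * MeanSquareMajorant.tau 5 d * (h : ℝ) * bigP D ^ 2 * (D : ℝ) ^ (-c₃))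
    {d h : ℕ} (hd : d ∈ Finset.Ico 1 (Skeleton.Nsupp D))
    (hh : h ∈ Finset.Ico 1 (Skeleton.Nsupp D)) :
    ∑ r ∈ (Finset.Ico 2 (Skeleton.Nsupp D)).filter
        (fun r => ((d * h * r : ℕ) : ℝ) < Skeleton.bigP D / Skeleton.bigT D ^ 2 ∧ ¬ r < D),
        term713 c' D a₁ (d, h, r) ≤
      ((Nat.log 2 (Skeleton.Nsupp D) : ℕ) + 1 : ℝ) *
        ((1 + Real.log ((((Skeleton.Nsupp D : ℕ) : ℝ)) ^ 2)) ^ 2 * C₃ *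
          MeanSquareMajorant.tau 5 d * bigP D ^ 2 * (D : ℝ) ^ (-c₃) / ((d : ℝ) * h)) := by
  set N₁ : ℕ := Skeleton.Nsupp D with hN₁
  set I : ℕ := Nat.log 2 N₁ with hI
  set B' := (Finset.Ico 2 N₁).filter
    (fun r => ((d * h * r : ℕ) : ℝ) < Skeleton.bigP D / Skeleton.bigT D ^ 2 ∧ ¬ r < D) with hB'
  have hmaps : ∀ r ∈ B', Nat.log 2 (r / D) ∈ Finset.range (I + 1) := by
    intro r hr
    rw [hB', Finset.mem_filter, Finset.mem_Ico] at hr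
    rw [Finset.mem_range, Nat.lt_succ_iff, hI]
    exact Nat.log_mono_right (le_trans (Nat.div_le_self r D) hr.1.2.le)
  rw [← Finset.sum_fiberwise_of_maps_to hmaps]
  have hfib : ∀ i ∈ Finset.range (I + 1),
      ∑ r ∈ B'.filter (fun r => Nat.log 2 (r / D) = i), term713 c' D a₁ (d, h, r) ≤
        (1 + Real.log ((((Skeleton.Nsupp D : ℕ) : ℝ)) ^ 2)) ^ 2 * C₃ *
          MeanSquareMajorant.tau 5 d * bigP D ^ 2 * (D : ℝ) ^ (-c₃) / ((d : ℝ) * h) :=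
    fun i _ => fiber713X_le c' a₁ hC₃ hD h715D hd hh i
  refine (Finset.sum_le_sum hfib).trans ?_
  rw [Finset.sum_const, Finset.card_range, nsmul_eq_mul]
  push_cast
  try rfl

set_option maxHeartbeats 800000 in
/-- **The `r ≥ D` part of the extended (7.13)-sum**, summed over `1 ≤ d, h < Nsupp`: at most
`12000·M₅·C₃·P²·𝓛⁸¹·D^{−c₃}` GIVEN the extended-range (7.15)-bound for this `D` and `𝓛 ≥ 2`
(`#blocks ≤ 5𝓛⁹`, `Λ ≤ 25𝓛¹⁸`, `Σ_d τ₅(d)/d ≤ 32M₅𝓛⁴⁵`, `Σ_h 1/h ≤ 3𝓛⁹`).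
[cite: Zhang2022LandauSiegel, §7 (7.13)–(7.15) pp.37–38, tex L2005–L2030] -/
private theorem sum_bigRX_le (c' : ℝ) {D : ℕ} (a₁ : ℕ → ℂ) {C₃' c₃ : ℝ} (hC₃'0 : 0 ≤ C₃')
    (hD0 : 0 < D) (hℓ2 : 2 ≤ Skeleton.ell D)
    (h3 : ∀ (d h : ℕ) (R : ℝ), 0 < d → 0 < h → (D : ℝ) ≤ R →
      R * ((d * h : ℕ) : ℝ) ≤ Skeleton.bigP D / Skeleton.bigT D ^ 2 →
      R ^ (-(3 / 2 : ℝ)) * ∑ r ∈ dyadic R, ∑ θ : DirichletCharacter ℂ r,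
          (if θ.IsPrimitive then ‖frakS c' D a₁ r h d θ‖ else 0) ≤
        C₃' * MeanSquareMajorant.tau 5 d * (h : ℝ) * bigP D ^ 2 * (D : ℝ) ^ (-c₃)) :
    ∑ x ∈ (((Finset.Ico 1 (Skeleton.Nsupp D)) ×ˢ ((Finset.Ico 1 (Skeleton.Nsupp D)) ×ˢ
          (Finset.Ico 2 (Skeleton.Nsupp D)))).filter
        (fun x => ((x.1 * x.2.1 * x.2.2 : ℕ) : ℝ) <
          Skeleton.bigP D / Skeleton.bigT D ^ 2)).filter (fun x => ¬ x.2.2 < D),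
      term713 c' D a₁ x ≤
      12000 * MeanSquareMajorant.majorantConst 5 5 * C₃' * bigP D ^ 2 * Skeleton.ell D ^ 81 *
        (D : ℝ) ^ (-c₃) := by
  have hDpos : (0 : ℝ) < D := by exact_mod_cast hD0
  set M₅ : ℝ := MeanSquareMajorant.majorantConst 5 5 with hM₅
  have hM₅0 : 0 < M₅ := MeanSquareMajorant.majorantConst_pos 5 5
  set N₁ : ℕ := Skeleton.Nsupp D with hN₁
  obtain ⟨hN3, hlogN⟩ := nsupp_factsD hℓ2
  -- rewrite as `Σ_d Σ_h Σ_{r ∈ B'(d,h)}`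
  have hset : (((Finset.Ico 1 N₁) ×ˢ ((Finset.Ico 1 N₁) ×ˢ (Finset.Ico 2 N₁))).filter
      (fun x => ((x.1 * x.2.1 * x.2.2 : ℕ) : ℝ) <
        Skeleton.bigP D / Skeleton.bigT D ^ 2)).filter (fun x => ¬ x.2.2 < D) =
      ((Finset.Ico 1 N₁) ×ˢ ((Finset.Ico 1 N₁) ×ˢ (Finset.Ico 2 N₁))).filter
        (fun x => ((x.1 * x.2.1 * x.2.2 : ℕ) : ℝ) <
          Skeleton.bigP D / Skeleton.bigT D ^ 2 ∧ ¬ x.2.2 < D) := by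
    rw [Finset.filter_filter]
  rw [hset, Finset.sum_filter, Finset.sum_product, Finset.sum_congr rfl
    (fun d _ => Finset.sum_product (s := Finset.Ico 1 N₁) (t := Finset.Ico 2 N₁)
      (f := fun y => if (((d * y.1 * y.2 : ℕ) : ℝ) <
          Skeleton.bigP D / Skeleton.bigT D ^ 2 ∧ ¬ y.2 < D)
        then term713 c' D a₁ (d, y) else 0))]
  -- bound each `(d,h)`-sum by the blocks bound
  have hdh : ∀ d ∈ Finset.Ico 1 N₁, ∀ h ∈ Finset.Ico 1 N₁,
      ∑ r ∈ Finset.Ico 2 N₁, (if (((d * h * r : ℕ) : ℝ) <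
          Skeleton.bigP D / Skeleton.bigT D ^ 2 ∧ ¬ r < D)
          then term713 c' D a₁ (d, h, r) else 0) ≤
        ((Nat.log 2 N₁ : ℕ) + 1 : ℝ) *
          ((1 + Real.log (((N₁ : ℕ) : ℝ) ^ 2)) ^ 2 * C₃' * MeanSquareMajorant.tau 5 d *
            bigP D ^ 2 * (D : ℝ) ^ (-c₃) / ((d : ℝ) * h)) := by
    intro d hd h hh
    rw [← Finset.sum_filter]
    exact blocks713X_le c' a₁ hC₃'0 hD0 h3 hd hh
  refine (Finset.sum_le_sum fun d hd => Finset.sum_le_sum fun h hh => hdh d hd h hh).trans ?_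
  -- factor the `(d,h)`-sums (inequality chain)
  set L9 : ℝ := Skeleton.ell D ^ 9 with hL9
  have hℓ1 : 1 ≤ Skeleton.ell D := by linarith
  have hL9one : 1 ≤ L9 := by rw [hL9]; exact one_le_pow₀ hℓ1
  have hlog0 : 0 ≤ Real.log ((N₁ : ℕ) : ℝ) := Real.log_natCast_nonneg N₁
  have hI : ((Nat.log 2 N₁ : ℕ) + 1 : ℝ) ≤ 5 * L9 := by
    have h2I : ((2 : ℕ) ^ Nat.log 2 N₁ : ℕ) ≤ N₁ := Nat.pow_log_le_self 2 (by omega)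
    have h2I' : (2 : ℝ) ^ (Nat.log 2 N₁) ≤ N₁ := by exact_mod_cast h2I
    have hlog2 : (Nat.log 2 N₁ : ℝ) * Real.log 2 ≤ Real.log ((N₁ : ℕ) : ℝ) := by
      rw [← Real.log_pow]
      exact Real.log_le_log (by positivity) h2I'
    have hl2 : (1 / 2 : ℝ) < Real.log 2 := by
      have := Real.log_two_gt_d9; norm_num at this; linarith
    have h1 : (Nat.log 2 N₁ : ℝ) ≤ 2 * Real.log ((N₁ : ℕ) : ℝ) := by
      have hI0 : (0 : ℝ) ≤ Nat.log 2 N₁ := Nat.cast_nonneg _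
      nlinarith
    have h2 : Real.log ((N₁ : ℕ) : ℝ) ≤ 2 * L9 := by rw [hL9]; exact hlogN
    linarith
  have hΛ : (1 + Real.log (((N₁ : ℕ) : ℝ) ^ 2)) ^ 2 ≤ 25 * L9 ^ 2 := by
    rw [Real.log_pow, Nat.cast_ofNat]
    have h2 : Real.log ((N₁ : ℕ) : ℝ) ≤ 2 * L9 := by rw [hL9]; exact hlogN
    have h1 : 1 + 2 * Real.log ((N₁ : ℕ) : ℝ) ≤ 5 * L9 := by linarith
    calc (1 + 2 * Real.log ((N₁ : ℕ) : ℝ)) ^ 2 ≤ (5 * L9) ^ 2 :=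
          pow_le_pow_left₀ (by linarith) h1 2
      _ = 25 * L9 ^ 2 := by ring
  have hτ : ∑ d ∈ Finset.Ico 1 N₁, MeanSquareMajorant.tau 5 d / d ≤ M₅ * (2 * L9) ^ 5 := by
    have h1 := sum_Ico_tau_five_div_le hN3
    have h2 : Real.log ((N₁ : ℕ) : ℝ) ^ 5 ≤ (2 * L9) ^ 5 := by
      refine pow_le_pow_left₀ hlog0 ?_ 5
      rw [hL9]; exact hlogN
    calc ∑ d ∈ Finset.Ico 1 N₁, MeanSquareMajorant.tau 5 d / d
        ≤ M₅ * Real.log ((N₁ : ℕ) : ℝ) ^ 5 := h1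
      _ ≤ M₅ * (2 * L9) ^ 5 := mul_le_mul_of_nonneg_left h2 hM₅0.le
  have hharm : ∑ h ∈ Finset.Ico 1 N₁, (1 : ℝ) / h ≤ 3 * L9 := by
    have h1 := sum_Ico_inv_le_one_add_logD N₁
    have h2 : Real.log ((N₁ : ℕ) : ℝ) ≤ 2 * L9 := by rw [hL9]; exact hlogN
    linarith
  have hτ0 : 0 ≤ ∑ d ∈ Finset.Ico 1 N₁, MeanSquareMajorant.tau 5 d / d :=
    Finset.sum_nonneg fun d _ =>
      div_nonneg (MeanSquareMajorant.tau_nonneg 5 d) (Nat.cast_nonneg d)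
  have hh0 : 0 ≤ ∑ h ∈ Finset.Ico 1 N₁, (1 : ℝ) / h :=
    Finset.sum_nonneg fun h _ => div_nonneg zero_le_one (Nat.cast_nonneg h)
  have hP2 : 0 ≤ bigP D ^ 2 * (D : ℝ) ^ (-c₃) :=
    mul_nonneg (pow_nonneg (Real.exp_pos _).le 2) (Real.rpow_nonneg hDpos.le _)
  -- each `(d,h)`-cell of the bound factors through `τ₅(d)/d` and `1/h`
  have hfac : ∑ d ∈ Finset.Ico 1 N₁, ∑ h ∈ Finset.Ico 1 N₁,
      ((Nat.log 2 N₁ : ℕ) + 1 : ℝ) *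
        ((1 + Real.log (((N₁ : ℕ) : ℝ) ^ 2)) ^ 2 * C₃' * MeanSquareMajorant.tau 5 d *
          bigP D ^ 2 * (D : ℝ) ^ (-c₃) / ((d : ℝ) * h)) =
      ((Nat.log 2 N₁ : ℕ) + 1 : ℝ) * (1 + Real.log (((N₁ : ℕ) : ℝ) ^ 2)) ^ 2 * C₃' *
        bigP D ^ 2 * (D : ℝ) ^ (-c₃) *
        ((∑ d ∈ Finset.Ico 1 N₁, MeanSquareMajorant.tau 5 d / d) *
          ∑ h ∈ Finset.Ico 1 N₁, (1 : ℝ) / h) := by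
    rw [Finset.sum_mul_sum, Finset.mul_sum]
    refine Finset.sum_congr rfl fun d hd => ?_
    rw [Finset.mul_sum]
    refine Finset.sum_congr rfl fun h hh => ?_
    rw [Finset.mem_Ico] at hd hh
    have hd0 : (d : ℝ) ≠ 0 := by exact_mod_cast (by omega : d ≠ 0)
    have hh0' : (h : ℝ) ≠ 0 := by exact_mod_cast (by omega : h ≠ 0)
    field_simp
    try ring
  rw [hfac]
  calc ((Nat.log 2 N₁ : ℕ) + 1 : ℝ) * (1 + Real.log (((N₁ : ℕ) : ℝ) ^ 2)) ^ 2 * C₃' *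
        bigP D ^ 2 * (D : ℝ) ^ (-c₃) *
        ((∑ d ∈ Finset.Ico 1 N₁, MeanSquareMajorant.tau 5 d / d) *
          ∑ h ∈ Finset.Ico 1 N₁, (1 : ℝ) / h)
      ≤ (5 * L9) * (25 * L9 ^ 2) * C₃' * bigP D ^ 2 * (D : ℝ) ^ (-c₃) *
          ((M₅ * (2 * L9) ^ 5) * (3 * L9)) := by
        have hA : ((Nat.log 2 N₁ : ℕ) + 1 : ℝ) * (1 + Real.log (((N₁ : ℕ) : ℝ) ^ 2)) ^ 2 ≤
            (5 * L9) * (25 * L9 ^ 2) := by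
          refine mul_le_mul hI hΛ (sq_nonneg _) ?_
          positivity
        have hB : (∑ d ∈ Finset.Ico 1 N₁, MeanSquareMajorant.tau 5 d / d) *
            ∑ h ∈ Finset.Ico 1 N₁, (1 : ℝ) / h ≤ (M₅ * (2 * L9) ^ 5) * (3 * L9) :=
          mul_le_mul hτ hharm hh0 (by positivity)
        calc _ = (((Nat.log 2 N₁ : ℕ) + 1 : ℝ) * (1 + Real.log (((N₁ : ℕ) : ℝ) ^ 2)) ^ 2) *
              (C₃' * (bigP D ^ 2 * (D : ℝ) ^ (-c₃))) *
              ((∑ d ∈ Finset.Ico 1 N₁, MeanSquareMajorant.tau 5 d / d) *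
                ∑ h ∈ Finset.Ico 1 N₁, (1 : ℝ) / h) := by ring
          _ ≤ ((5 * L9) * (25 * L9 ^ 2)) * (C₃' * (bigP D ^ 2 * (D : ℝ) ^ (-c₃))) *
              ((M₅ * (2 * L9) ^ 5) * (3 * L9)) := by
              apply mul_le_mul (mul_le_mul_of_nonneg_right hA (mul_nonneg hC₃'0 hP2)) hB
                (mul_nonneg hτ0 hh0) (by positivity)
          _ = _ := by ring
    _ = 12000 * M₅ * C₃' * bigP D ^ 2 * Skeleton.ell D ^ 81 * (D : ℝ) ^ (-c₃) := by
        rw [hL9]; ring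

/-! ## The full extended-range triple sum, and THE DECL-WANTED -/

/-- **The extended-range (7.13)-shaped triple sum over the FULL (7.2) support.** There are
`c > 0` and all-large thresholds with: for all large `D` under (A) and `𝐚₁` admissible (7.2),
`Σ term713 ≤ 2·P²·D^{−c}` over all triples `1 ≤ d, h < Nsupp`, `2 ≤ r < Nsupp` with
`dhr < PT⁻²`. The `r < D` part is `sum_tripleX_smallR_le` (F3a); the `r ≥ D` part is
`sum_bigRX_le` with the extended-range (7.15) `eq715X` (F2b); the `𝓛⁸¹` of the big-`R` part is
absorbed into `D^{−c₃/2}`. [cite: Zhang2022LandauSiegel, §7 (7.13)–(7.15) pp.37–39] -/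
theorem sum_tripleX_le (c' : ℝ) (B : ℝ) :
    ∃ c : ℝ, 0 < c ∧ Skeleton.ForAllLarge fun D _ χ => Skeleton.AssumptionA D χ →
      ∀ a₁ : ℕ → ℂ, Skeleton.Adm72 D B a₁ →
        ∑ x ∈ ((Finset.Ico 1 (Skeleton.Nsupp D)) ×ˢ ((Finset.Ico 1 (Skeleton.Nsupp D)) ×ˢ
              (Finset.Ico 2 (Skeleton.Nsupp D)))).filter
            (fun x => ((x.1 * x.2.1 * x.2.2 : ℕ) : ℝ) <
              Skeleton.bigP D / Skeleton.bigT D ^ 2),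
          term713 c' D a₁ x ≤
        2 * Skeleton.bigP D ^ 2 * (D : ℝ) ^ (-c) := by
  obtain ⟨c₃, hc₃, C₃, D₃, h715⟩ := eq715X c' B
  set C₃' : ℝ := max C₃ 0 with hC₃'
  have hC₃'0 : 0 ≤ C₃' := le_max_right _ _
  set M₅ : ℝ := MeanSquareMajorant.majorantConst 5 5 with hM₅
  have hM₅0 : 0 < M₅ := MeanSquareMajorant.majorantConst_pos 5 5
  obtain ⟨DS, hsmall⟩ := sum_tripleX_smallR_le c' B
  obtain ⟨Dabs, habs⟩ := ell_pow_mul_rpow_neg_eventuallyD 81 (show 0 < c₃ / 2 by linarith)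
    (show (0 : ℝ) < 1 by norm_num) (12000 * M₅ * C₃')
  obtain ⟨Dell, hell⟩ := Skeleton.exists_nat_forall_le_ell 2
  refine ⟨min 1 (c₃ / 2), lt_min one_pos (by linarith), ?_⟩
  refine ⟨D₃ + DS + Dabs + Dell + 3, fun D _ χ hD hq hp hA a₁ ha => ?_⟩
  have hD₃ : D₃ ≤ D := by omega
  have hDS : DS ≤ D := by omega
  have hDabs : Dabs ≤ D := by omega
  have hDell : Dell ≤ D := by omega
  have hD3 : 3 ≤ D := by omega
  have hD0 : 0 < D := by omega
  have hDpos : (0 : ℝ) < D := by exact_mod_cast hD0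
  have hD1 : (1 : ℝ) ≤ D := by exact_mod_cast (show 1 ≤ D by omega)
  have hℓ2 : 2 ≤ Skeleton.ell D := hell D hDell
  set N₁ : ℕ := Skeleton.Nsupp D with hN₁
  set T := ((Finset.Ico 1 N₁) ×ˢ ((Finset.Ico 1 N₁) ×ˢ (Finset.Ico 2 N₁))).filter
    (fun x => ((x.1 * x.2.1 * x.2.2 : ℕ) : ℝ) < Skeleton.bigP D / Skeleton.bigT D ^ 2) with hT
  have hterm0 : ∀ x, 0 ≤ term713 c' D a₁ x := by
    intro x
    unfold term713
    refine mul_nonneg (inv_nonneg.mpr (by positivity)) (Finset.sum_nonneg fun θ _ => ?_)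
    split_ifs
    · exact norm_nonneg _
    · exact le_rfl
  -- split at `r < D`
  have hsplit : ∑ x ∈ T, term713 c' D a₁ x =
      ∑ x ∈ T.filter (fun x => x.2.2 < D), term713 c' D a₁ x +
        ∑ x ∈ T.filter (fun x => ¬ x.2.2 < D), term713 c' D a₁ x :=
    (Finset.sum_filter_add_sum_filter_not _ _ _).symm
  -- the `r < D` part (F3a)
  have hsmallD := hsmall D χ hDS hq hp hA a₁ ha
  -- the `r ≥ D` part
  have h715D : ∀ (d h : ℕ) (R : ℝ), 0 < d → 0 < h → (D : ℝ) ≤ R →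
      R * ((d * h : ℕ) : ℝ) ≤ Skeleton.bigP D / Skeleton.bigT D ^ 2 →
      R ^ (-(3 / 2 : ℝ)) * ∑ r ∈ dyadic R, ∑ θ : DirichletCharacter ℂ r,
          (if θ.IsPrimitive then ‖frakS c' D a₁ r h d θ‖ else 0) ≤
        C₃' * MeanSquareMajorant.tau 5 d * (h : ℝ) * bigP D ^ 2 * (D : ℝ) ^ (-c₃) := by
    intro d h R hd hh hDR hRX
    refine (h715 D χ hD₃ hq hp hA a₁ ha d h R hd hh hDR hRX).trans ?_
    have h0 : 0 ≤ MeanSquareMajorant.tau 5 d * (h : ℝ) * bigP D ^ 2 * (D : ℝ) ^ (-c₃) := by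
      have := MeanSquareMajorant.tau_nonneg 5 d
      have := Real.rpow_nonneg hDpos.le (-c₃)
      positivity
    calc C₃ * MeanSquareMajorant.tau 5 d * (h : ℝ) * bigP D ^ 2 * (D : ℝ) ^ (-c₃)
        = C₃ * (MeanSquareMajorant.tau 5 d * (h : ℝ) * bigP D ^ 2 * (D : ℝ) ^ (-c₃)) := by ring
      _ ≤ C₃' * (MeanSquareMajorant.tau 5 d * (h : ℝ) * bigP D ^ 2 * (D : ℝ) ^ (-c₃)) :=
          mul_le_mul_of_nonneg_right (le_max_left _ _) h0
      _ = C₃' * MeanSquareMajorant.tau 5 d * (h : ℝ) * bigP D ^ 2 * (D : ℝ) ^ (-c₃) := by ring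
  have hbig : ∑ x ∈ T.filter (fun x => ¬ x.2.2 < D), term713 c' D a₁ x ≤
      12000 * M₅ * C₃' * bigP D ^ 2 * Skeleton.ell D ^ 81 * (D : ℝ) ^ (-c₃) := by
    have := sum_bigRX_le c' a₁ hC₃'0 hD0 hℓ2 h715D
    rw [hT]
    exact this
  -- absorb the `𝓛⁸¹`
  have habs' : 12000 * M₅ * C₃' * Skeleton.ell D ^ 81 * (D : ℝ) ^ (-(c₃ / 2)) ≤ 1 :=
    habs D hDabs
  have hbig2 : 12000 * M₅ * C₃' * bigP D ^ 2 * Skeleton.ell D ^ 81 * (D : ℝ) ^ (-c₃) ≤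
      bigP D ^ 2 * (D : ℝ) ^ (-(c₃ / 2)) := by
    have hsplitc : (D : ℝ) ^ (-c₃) = (D : ℝ) ^ (-(c₃ / 2)) * (D : ℝ) ^ (-(c₃ / 2)) := by
      rw [← Real.rpow_add hDpos]
      ring_nf
    have hP20 : 0 ≤ bigP D ^ 2 := pow_nonneg (Real.exp_pos _).le 2
    have hr0 : 0 ≤ (D : ℝ) ^ (-(c₃ / 2)) := Real.rpow_nonneg hDpos.le _
    calc 12000 * M₅ * C₃' * bigP D ^ 2 * Skeleton.ell D ^ 81 * (D : ℝ) ^ (-c₃)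
        = (12000 * M₅ * C₃' * Skeleton.ell D ^ 81 * (D : ℝ) ^ (-(c₃ / 2))) *
            (bigP D ^ 2 * (D : ℝ) ^ (-(c₃ / 2))) := by
          rw [hsplitc]; ring
      _ ≤ 1 * (bigP D ^ 2 * (D : ℝ) ^ (-(c₃ / 2))) :=
          mul_le_mul_of_nonneg_right habs' (by positivity)
      _ = bigP D ^ 2 * (D : ℝ) ^ (-(c₃ / 2)) := one_mul _
  -- the two exponent comparisons
  have hmono1 : (D : ℝ) ^ (-(1 : ℝ)) ≤ (D : ℝ) ^ (-min 1 (c₃ / 2)) :=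
    Real.rpow_le_rpow_of_exponent_le hD1 (neg_le_neg (min_le_left _ _))
  have hmono2 : (D : ℝ) ^ (-(c₃ / 2)) ≤ (D : ℝ) ^ (-min 1 (c₃ / 2)) :=
    Real.rpow_le_rpow_of_exponent_le hD1 (neg_le_neg (min_le_right _ _))
  have hP20 : 0 ≤ Skeleton.bigP D ^ 2 := pow_nonneg (Real.exp_pos _).le 2
  calc ∑ x ∈ T, term713 c' D a₁ x
      = ∑ x ∈ T.filter (fun x => x.2.2 < D), term713 c' D a₁ x +
          ∑ x ∈ T.filter (fun x => ¬ x.2.2 < D), term713 c' D a₁ x := hsplit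
    _ ≤ Skeleton.bigP D ^ 2 * (D : ℝ) ^ (-(1 : ℝ)) +
          12000 * M₅ * C₃' * bigP D ^ 2 * Skeleton.ell D ^ 81 * (D : ℝ) ^ (-c₃) := by
        refine add_le_add ?_ hbig
        exact hsmallD
    _ ≤ Skeleton.bigP D ^ 2 * (D : ℝ) ^ (-(1 : ℝ)) +
          Skeleton.bigP D ^ 2 * (D : ℝ) ^ (-(c₃ / 2)) := add_le_add le_rfl hbig2
    _ ≤ Skeleton.bigP D ^ 2 * (D : ℝ) ^ (-min 1 (c₃ / 2)) +
          Skeleton.bigP D ^ 2 * (D : ℝ) ^ (-min 1 (c₃ / 2)) :=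
        add_le_add (mul_le_mul_of_nonneg_left hmono1 hP20)
          (mul_le_mul_of_nonneg_left hmono2 hP20)
    _ = 2 * Skeleton.bigP D ^ 2 * (D : ℝ) ^ (-min 1 (c₃ / 2)) := by ring

/-- **THE DECL-WANTED of GAP-LEDGER row G-adj2-1** (the (7.15)-type total over the range the
printed (7.13) DROPS): there are `c > 0` and all-large thresholds with, for all large `D` under
(A) and every `𝐚₁` with (7.2), the (7.13)-shaped triple sum `Σ (dhφ(hr)√r)⁻¹ Σ*_θ |𝔰(r,h,d;θ)|`
over the triples with `P₁ ≤ dhr < PT⁻²` and `r > 1` bounded by `2·P²·D^{−c}`. The printed (7.13)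
restricts to `dhr < P₁` although (7.2) supports coefficients up to `PT⁻²`
(`Skeleton.P1_lt_P_div_T_sq`; the certified statement/proof mismatch of the row, p412643): this
theorem bounds exactly the dropped range — a monotone consequence of `sum_tripleX_le`.
[cite: Zhang2022LandauSiegel, §7 (7.13)/(7.15) pp.37–38, tex L2005–L2030; (7.2) tex L1813–L1815] -/
theorem extension713_sum_le (c' : ℝ) (B : ℝ) :
    ∃ c : ℝ, 0 < c ∧ Skeleton.ForAllLarge fun D _ χ => Skeleton.AssumptionA D χ →
      ∀ a₁ : ℕ → ℂ, Skeleton.Adm72 D B a₁ →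
        ∑ x ∈ ((Finset.Ico 1 (Skeleton.Nsupp D)) ×ˢ ((Finset.Ico 1 (Skeleton.Nsupp D)) ×ˢ
              (Finset.Ico 2 (Skeleton.Nsupp D)))).filter
            (fun x => Skeleton.P1 D ≤ ((x.1 * x.2.1 * x.2.2 : ℕ) : ℝ) ∧
              ((x.1 * x.2.1 * x.2.2 : ℕ) : ℝ) < Skeleton.bigP D / Skeleton.bigT D ^ 2),
          term713 c' D a₁ x ≤
        2 * Skeleton.bigP D ^ 2 * (D : ℝ) ^ (-c) := by
  obtain ⟨c, hc, D₀, hfull⟩ := sum_tripleX_le c' B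
  refine ⟨c, hc, D₀, fun D _ χ hD hq hp hA a₁ ha => ?_⟩
  have hterm0 : ∀ x, 0 ≤ term713 c' D a₁ x := by
    intro x
    unfold term713
    refine mul_nonneg (inv_nonneg.mpr (by positivity)) (Finset.sum_nonneg fun θ _ => ?_)
    split_ifs
    · exact norm_nonneg _
    · exact le_rfl
  have hsub : ((Finset.Ico 1 (Skeleton.Nsupp D)) ×ˢ ((Finset.Ico 1 (Skeleton.Nsupp D)) ×ˢ
        (Finset.Ico 2 (Skeleton.Nsupp D)))).filter
      (fun x => Skeleton.P1 D ≤ ((x.1 * x.2.1 * x.2.2 : ℕ) : ℝ) ∧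
        ((x.1 * x.2.1 * x.2.2 : ℕ) : ℝ) < Skeleton.bigP D / Skeleton.bigT D ^ 2) ⊆
      ((Finset.Ico 1 (Skeleton.Nsupp D)) ×ˢ ((Finset.Ico 1 (Skeleton.Nsupp D)) ×ˢ
        (Finset.Ico 2 (Skeleton.Nsupp D)))).filter
      (fun x => ((x.1 * x.2.1 * x.2.2 : ℕ) : ℝ) <
        Skeleton.bigP D / Skeleton.bigT D ^ 2) := by
    intro x hx
    rw [Finset.mem_filter] at hx ⊢
    exact ⟨hx.1, hx.2.2⟩
  calc ∑ x ∈ ((Finset.Ico 1 (Skeleton.Nsupp D)) ×ˢ ((Finset.Ico 1 (Skeleton.Nsupp D)) ×ˢ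
          (Finset.Ico 2 (Skeleton.Nsupp D)))).filter
        (fun x => Skeleton.P1 D ≤ ((x.1 * x.2.1 * x.2.2 : ℕ) : ℝ) ∧
          ((x.1 * x.2.1 * x.2.2 : ℕ) : ℝ) < Skeleton.bigP D / Skeleton.bigT D ^ 2),
        term713 c' D a₁ x
      ≤ ∑ x ∈ ((Finset.Ico 1 (Skeleton.Nsupp D)) ×ˢ ((Finset.Ico 1 (Skeleton.Nsupp D)) ×ˢ
            (Finset.Ico 2 (Skeleton.Nsupp D)))).filter
          (fun x => ((x.1 * x.2.1 * x.2.2 : ℕ) : ℝ) <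
            Skeleton.bigP D / Skeleton.bigT D ^ 2),
          term713 c' D a₁ x :=
        Finset.sum_le_sum_of_subset_of_nonneg hsub fun x _ _ => hterm0 x
    _ ≤ 2 * Skeleton.bigP D ^ 2 * (D : ℝ) ^ (-c) := hfull D χ hD hq hp hA a₁ ha

end Literature.NumberTheory.LFunctions.Zhang2022.Section7cStatements
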